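import Summits.Ventures.Crystal3D.StickySpheres.Open8B
import HarnessLib

/-!
# The pattern `Nine22B` (the cone over the snub disphenoid) is not realisable — hence `C(9) = 21`

Venture `Crystal3D` (cell `pub-crystal3d`, seat p2). `Nine22B` (graph6 `HQyvex{`) is the last open pattern of the
`(9,22)` obstruction set (`ineq/FORMAL-C9.md` §7): the `18` contacts of the snub-disphenoid graph on eight balls
`a, b, c, d, e, f, g, h` plus a ninth ball `x` touching its four degree-`4` balls `a, b, e, f`. With it,
`ContactNine.maxContacts_three_nine_of_no_Nine22B` gives `maxContacts 3 9 = 21` unconditionally (`ContactNineFinal.lean`).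

Proof WITHOUT coordinates, angles or certificates (the method of `FiveRing.lean` / `Open8B.lean`).
* `a, b, g, h` all touch `c` and `d`, so they lie on the circle `K₁ = S(c,1) ∩ S(d,1)` (centre `n₁ = (c+d)/2`, axis
  `u = d − c`, squared radius `R = 1 − S`, `S = ‖u‖²/4`); `e, f, c, d` all touch `g` and `h`, so they lie on
  `K₂ = S(g,1) ∩ S(h,1)` (centre `n₂ = (g+h)/2`, axis `v = h − g`, `R' = 1 − T`, `T = ‖v‖²/4`).
* On `K₁` the chords `ga, ab, bh` are contacts; the REFLECTION RULE (`smul_add_eq_smul_of_circle`) at `a` and at `b` gives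
  `R (h − g) = (3R − 1)(b − a)` and `R (g + h − 2n₁) = (R − 1)(a + b − 2n₁)`; with `dist g h ≥ 1` this forces `S ≤ 1/2`
  and puts the midpoint of `ab` on the line `ℓ = n₁ + ℝ (n₂ − n₁)` BEFORE `n₁`. Symmetrically on `K₂` (chords `ce, ef, fd`):
  `T ≤ 1/2` and the midpoint of `ef` lies on `ℓ` BEYOND `n₂`; moreover `u ⊥ v`, `u, v ⊥ n₂ − n₁ ≠ 0`.
* `x` touches `a, b` and `e, f`, so `x − n₁ ⊥ u, v`, i.e. `x = n₁ + λ (g + h − c − d)` lies on `ℓ`. Then `dist x a = 1` and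
  `dist x c ≥ 1` give `λ ≤ 0` (`line_param_nonpos`), while `dist x e = 1` and `dist x g ≥ 1` give `λ ≥ 1/2`. Contradiction.

HONEST FRAMING: elementary Euclidean geometry, [folklore]; it discharges the hypothesis `hN` of `ContactNine`. Nothing about
crystallization.
-/

noncomputable section

open Real RealInnerProductSpace

namespace Summit.Ventures.Crystal3D

/-! ### 1. Two real-number lemmas -/

/-- From `R² D = (3R − 1)²`, `D ≥ 1` and `4R − 1 > 0`: `R ≥ 1/2` (four points pairwise `≥ 1` apart on a circle of squared
radius `R`, three consecutive chords equal to `1`). [folklore] -/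
theorem half_le_of_three_chords {R D : ℝ} (q : R * (R * D) = (3 * R - 1) * ((3 * R - 1) * 1)) (hD : 1 ≤ D)
    (nd : 0 < 2 * R + 2 * (R - 1 / 2)) : 1 / 2 ≤ R := by
  by_contra hlt
  push Not at hlt
  have h1 : R * R * 1 ≤ R * R * D := mul_le_mul_of_nonneg_left hD (mul_self_nonneg R)
  have h2 : 0 < (1 / 2 - R) * (4 * R - 1) := mul_pos (by linarith) (by linarith)
  nlinarith [q, h1, h2]

/-- **The line parameter is non-positive.** Real-number core of the endgame: `S ∈ (0, 1/2]`, `R = 1 − S`, `κ > 0`;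
`(E1)` is `dist x a = 1`, `(E3)` is `‖a + b − 2n₁‖² = 4R − 1`, `(E2)` is `dist x c ≥ 1`, all written along the line
`x = n₁ + l • K` with `⟪K, K⟫ = κ`. Then `l ≤ 0`. [folklore] -/
theorem line_param_nonpos {S R κ l : ℝ} (hS : 0 < S) (hR : 0 < R) (hκ : 0 < κ) (hRS : R = 1 - S) (hS2 : S ≤ 1 / 2)
    (E1 : S * (S * (3 / 4)) = (S * l + R / 2) * ((S * l + R / 2) * κ))
    (E3 : S * (S * (4 * R - 1)) = R * (R * κ)) (E2 : 1 ≤ l * (l * κ) + S) : l ≤ 0 := by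
  have key : S * R * κ * l = S ^ 3 - S ^ 2 * (l * (l * κ)) := by
    linear_combination (-1 : ℝ) * E1 + (1 / 4 : ℝ) * E3 - S ^ 2 * hRS
  have h1 : S ^ 2 * 1 ≤ S ^ 2 * (l * (l * κ) + S) := mul_le_mul_of_nonneg_left E2 (sq_nonneg S)
  have h2 : S ^ 3 - S ^ 2 * (l * (l * κ)) ≤ 0 := by nlinarith [h1, hS2, sq_nonneg S]
  by_contra hl
  push Not at hl
  have h3 : 0 < S * R * κ * l := mul_pos (mul_pos (mul_pos hS hR) hκ) hl
  linarith

/-! ### 2. The snub disphenoid with a ball on its four degree-4 vertices -/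

/-- **Core statement.** Balls `a, …, h` with the `18` snub-disphenoid contacts (`c, d` touch `a, b, g, h`; `g, h` touch
`c, d, e, f`; chords `ab, ga, hb, ef, ce, df`), a ninth ball `x` touching `a, b, e, f`, and the displayed separations:
impossible. [folklore] -/
theorem no_snub_disphenoid_cone {a b c d e f g h x : EuclideanSpace ℝ (Fin 3)}
    (hac : dist a c = 1) (had : dist a d = 1) (hbc : dist b c = 1) (hbd : dist b d = 1)
    (hgc : dist g c = 1) (hgd : dist g d = 1) (hhc : dist h c = 1) (hhd : dist h d = 1)
    (heg : dist e g = 1) (heh : dist e h = 1) (hfg : dist f g = 1) (hfh : dist f h = 1)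
    (hab : dist a b = 1) (hga : dist g a = 1) (hhb : dist h b = 1)
    (hef : dist e f = 1) (hce : dist c e = 1) (hdf : dist d f = 1)
    (hxa : dist x a = 1) (hxb : dist x b = 1) (hxe : dist x e = 1) (hxf : dist x f = 1)
    (scd : 1 ≤ dist c d) (sgh : 1 ≤ dist g h) (sgb : g ≠ b) (sah : a ≠ h) (scf : c ≠ f) (sed : e ≠ d)
    (sxc : 1 ≤ dist x c) (sxg : 1 ≤ dist x g) : False := by
  -- ### Part 1: the circle `K₁ ∋ a, b, g, h` about the axis `cd`
  have ncd : c ≠ d := fun h0 => by rw [h0, dist_self] at scd; linarith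
  have ngh : g ≠ h := fun h0 => by rw [h0, dist_self] at sgh; linarith
  obtain ⟨u, hu⟩ : ∃ u : EuclideanSpace ℝ (Fin 3), u = d - c := ⟨_, rfl⟩
  have hu0 : u ≠ 0 := by rw [hu]; exact sub_ne_zero.2 (Ne.symm ncd)
  have CA := circle_of_dist_eq_one hac had
  have CB := circle_of_dist_eq_one hbc hbd
  have CG := circle_of_dist_eq_one hgc hgd
  have CH := circle_of_dist_eq_one hhc hhd
  rw [← hu] at CA CB CG CH
  obtain ⟨A, hA⟩ : ∃ w : EuclideanSpace ℝ (Fin 3), w = a - c - (1 / 2 : ℝ) • u := ⟨_, rfl⟩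
  obtain ⟨B, hB⟩ : ∃ w : EuclideanSpace ℝ (Fin 3), w = b - c - (1 / 2 : ℝ) • u := ⟨_, rfl⟩
  obtain ⟨G, hG⟩ : ∃ w : EuclideanSpace ℝ (Fin 3), w = g - c - (1 / 2 : ℝ) • u := ⟨_, rfl⟩
  obtain ⟨H, hH⟩ : ∃ w : EuclideanSpace ℝ (Fin 3), w = h - c - (1 / 2 : ℝ) • u := ⟨_, rfl⟩
  rw [← hA] at CA
  rw [← hB] at CB
  rw [← hG] at CG
  rw [← hH] at CH
  obtain ⟨R, hR⟩ : ∃ r : ℝ, r = 1 - ⟪u, u⟫ / 4 := ⟨_, rfl⟩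
  rw [← hR] at CA CB CG CH
  obtain ⟨oA, nA⟩ := CA
  obtain ⟨oB, nB⟩ := CB
  obtain ⟨oG, nG⟩ := CG
  obtain ⟨oH, nH⟩ := CH
  have dBA : b - a = B - A := by rw [hB, hA]; abel
  have dGA : g - a = G - A := by rw [hG, hA]; abel
  have dAB : a - b = A - B := by rw [hA, hB]; abel
  have dHB : h - b = H - B := by rw [hH, hB]; abel
  have dGB : g - b = G - B := by rw [hG, hB]; abel
  have dAH : a - h = A - H := by rw [hA, hH]; abel
  have dHG : h - g = H - G := by rw [hH, hG]; abel
  have hba : dist b a = 1 := by rw [dist_comm]; exact hab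
  have iGA : ⟪G, A⟫ = R - 1 / 2 := by
    have q := inner_eq_of_sub_eq dGA nG nA; rw [hga] at q; linarith only [q]
  have iBA : ⟪B, A⟫ = R - 1 / 2 := by
    have q := inner_eq_of_sub_eq dBA nB nA; rw [hba] at q; linarith only [q]
  have iAB : ⟪A, B⟫ = R - 1 / 2 := by
    have q := inner_eq_of_sub_eq dAB nA nB; rw [hab] at q; linarith only [q]
  have iHB : ⟪H, B⟫ = R - 1 / 2 := by
    have q := inner_eq_of_sub_eq dHB nH nB; rw [hhb] at q; linarith only [q]
  have neGB : G ≠ B := fun h0 => sgb (sub_eq_zero.1 (by rw [dGB, h0, sub_self]))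
  have neAH : A ≠ H := fun h0 => sah (sub_eq_zero.1 (by rw [dAH, h0, sub_self]))
  -- reflection rule at `a` (neighbours `g`, `b`) and at `b` (neighbours `a`, `h`)
  have R1 := smul_add_eq_smul_of_circle hu0 oA oG oB nA nG nB iGA iBA neGB
  have R2 := smul_add_eq_smul_of_circle hu0 oB oA oH nB nA nH iAB iHB neAH
  have nd1 : 0 < 2 * R + 2 * (R - 1 / 2) := circle_nondeg nA nG nB iGA iBA neGB
  have Ei : R • (H - G) = (3 * R - 1) • (B - A) := by
    have e1 : R • (H - G) = R • (A + H) - R • (G + B) + R • (B - A) := by module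
    rw [e1, R1, R2]; module
  have Eii : R • (G + H) = (R - 1) • (A + B) := by
    have e1 : R • (G + H) = R • (G + B) + R • (A + H) - R • (A + B) := by module
    rw [e1, R1, R2]; module
  -- `S := ⟪u,u⟫/4 ≤ 1/2` from `dist g h ≥ 1`
  have nHG : ⟪H - G, H - G⟫ = dist h g ^ 2 := by rw [← dHG]; exact inner_self_eq_of_dist rfl
  have nBA : ⟪B - A, B - A⟫ = 1 := by rw [← dBA, inner_self_eq_of_dist hba]; norm_num
  have sq_hg : (1 : ℝ) ≤ dist h g ^ 2 := by
    have q : 1 ≤ dist h g := by rw [dist_comm]; exact sgh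
    calc (1 : ℝ) = 1 * 1 := by ring
      _ ≤ dist h g * dist h g := mul_le_mul q q zero_le_one (zero_le_one.trans q)
      _ = dist h g ^ 2 := by ring
  have hRhalf : 1 / 2 ≤ R := by
    have q := congrArg (fun z => ⟪z, z⟫) Ei
    simp only [real_inner_smul_left, real_inner_smul_right] at q
    rw [nHG, nBA] at q
    exact half_le_of_three_chords q sq_hg nd1
  have huu : 0 < ⟪u, u⟫ := real_inner_self_pos.2 hu0
  -- ### Part 2: the circle `K₂ ∋ e, f, c, d` about the axis `gh`
  obtain ⟨v, hv⟩ : ∃ v : EuclideanSpace ℝ (Fin 3), v = h - g := ⟨_, rfl⟩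
  have hv0 : v ≠ 0 := by rw [hv]; exact sub_ne_zero.2 (Ne.symm ngh)
  have hcg : dist c g = 1 := by rw [dist_comm]; exact hgc
  have hch : dist c h = 1 := by rw [dist_comm]; exact hhc
  have hdg : dist d g = 1 := by rw [dist_comm]; exact hgd
  have hdh : dist d h = 1 := by rw [dist_comm]; exact hhd
  have CC := circle_of_dist_eq_one hcg hch
  have CD := circle_of_dist_eq_one hdg hdh
  have CE := circle_of_dist_eq_one heg heh
  have CF := circle_of_dist_eq_one hfg hfh
  rw [← hv] at CC CD CE CF
  obtain ⟨C, hC⟩ : ∃ w : EuclideanSpace ℝ (Fin 3), w = c - g - (1 / 2 : ℝ) • v := ⟨_, rfl⟩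
  obtain ⟨D, hD⟩ : ∃ w : EuclideanSpace ℝ (Fin 3), w = d - g - (1 / 2 : ℝ) • v := ⟨_, rfl⟩
  obtain ⟨E, hE⟩ : ∃ w : EuclideanSpace ℝ (Fin 3), w = e - g - (1 / 2 : ℝ) • v := ⟨_, rfl⟩
  obtain ⟨F, hF⟩ : ∃ w : EuclideanSpace ℝ (Fin 3), w = f - g - (1 / 2 : ℝ) • v := ⟨_, rfl⟩
  rw [← hC] at CC
  rw [← hD] at CD
  rw [← hE] at CE
  rw [← hF] at CF
  obtain ⟨R', hR'⟩ : ∃ r : ℝ, r = 1 - ⟪v, v⟫ / 4 := ⟨_, rfl⟩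
  rw [← hR'] at CC CD CE CF
  obtain ⟨oC, nC⟩ := CC
  obtain ⟨oD, nD⟩ := CD
  obtain ⟨oE, nE⟩ := CE
  obtain ⟨oF, nF⟩ := CF
  have dCE : c - e = C - E := by rw [hC, hE]; abel
  have dFE : f - e = F - E := by rw [hF, hE]; abel
  have dEF : e - f = E - F := by rw [hE, hF]; abel
  have dDF : d - f = D - F := by rw [hD, hF]; abel
  have dCF : c - f = C - F := by rw [hC, hF]; abel
  have dED : e - d = E - D := by rw [hE, hD]; abel
  have dDC : d - c = D - C := by rw [hD, hC]; abel
  have hfe : dist f e = 1 := by rw [dist_comm]; exact hef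
  have iCE : ⟪C, E⟫ = R' - 1 / 2 := by
    have q := inner_eq_of_sub_eq dCE nC nE; rw [hce] at q; linarith only [q]
  have iFE : ⟪F, E⟫ = R' - 1 / 2 := by
    have q := inner_eq_of_sub_eq dFE nF nE; rw [hfe] at q; linarith only [q]
  have iEF : ⟪E, F⟫ = R' - 1 / 2 := by
    have q := inner_eq_of_sub_eq dEF nE nF; rw [hef] at q; linarith only [q]
  have iDF : ⟪D, F⟫ = R' - 1 / 2 := by
    have q := inner_eq_of_sub_eq dDF nD nF; rw [hdf] at q; linarith only [q]
  have neCF : C ≠ F := fun h0 => scf (sub_eq_zero.1 (by rw [dCF, h0, sub_self]))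
  have neED : E ≠ D := fun h0 => sed (sub_eq_zero.1 (by rw [dED, h0, sub_self]))
  -- reflection rule at `e` (neighbours `c`, `f`) and at `f` (neighbours `e`, `d`)
  have R3 := smul_add_eq_smul_of_circle hv0 oE oC oF nE nC nF iCE iFE neCF
  have R4 := smul_add_eq_smul_of_circle hv0 oF oE oD nF nE nD iEF iDF neED
  have nd2 : 0 < 2 * R' + 2 * (R' - 1 / 2) := circle_nondeg nE nC nF iCE iFE neCF
  have Ei' : R' • (D - C) = (3 * R' - 1) • (F - E) := by
    have e1 : R' • (D - C) = R' • (E + D) - R' • (C + F) + R' • (F - E) := by module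
    rw [e1, R3, R4]; module
  have Eii' : R' • (C + D) = (R' - 1) • (E + F) := by
    have e1 : R' • (C + D) = R' • (C + F) + R' • (E + D) - R' • (E + F) := by module
    rw [e1, R3, R4]; module
  -- `T := ⟪v,v⟫/4 ≤ 1/2` from `dist c d ≥ 1`
  have nDC : ⟪D - C, D - C⟫ = dist d c ^ 2 := by rw [← dDC]; exact inner_self_eq_of_dist rfl
  have nFE : ⟪F - E, F - E⟫ = 1 := by rw [← dFE, inner_self_eq_of_dist hfe]; norm_num
  have sq_dc : (1 : ℝ) ≤ dist d c ^ 2 := by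
    have q : 1 ≤ dist d c := by rw [dist_comm]; exact scd
    calc (1 : ℝ) = 1 * 1 := by ring
      _ ≤ dist d c * dist d c := mul_le_mul q q zero_le_one (zero_le_one.trans q)
      _ = dist d c ^ 2 := by ring
  have hR'half : 1 / 2 ≤ R' := by
    have q := congrArg (fun z => ⟪z, z⟫) Ei'
    simp only [real_inner_smul_left, real_inner_smul_right] at q
    rw [nDC, nFE] at q
    exact half_le_of_three_chords q sq_dc nd2
  have hvv : 0 < ⟪v, v⟫ := real_inner_self_pos.2 hv0
  -- ### Part 3: orthogonality; the line `ℓ` through `n₁ = (c+d)/2` and `n₂ = (g+h)/2`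
  have hvHG : v = H - G := by rw [hv, dHG]
  have huDC : u = D - C := by rw [hu, dDC]
  have hCD : C + D = -(G + H) := by rw [hC, hD, hG, hH, hu, hv]; module
  have ovu : ⟪v, u⟫ = 0 := by rw [hvHG, inner_sub_left, oH, oG, sub_zero]
  have oKu : ⟪G + H, u⟫ = 0 := by rw [inner_add_left, oG, oH, add_zero]
  have oKv : ⟪G + H, v⟫ = 0 := by
    rw [hvHG, inner_add_left, inner_sub_right, inner_sub_right, nG, nH, real_inner_comm G H]; ring
  have nApB : ⟪A + B, A + B⟫ = 4 * R - 1 := by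
    rw [real_inner_add_add_self, nA, iAB, nB]; ring
  have nEpF : ⟪E + F, E + F⟫ = 4 * R' - 1 := by
    rw [real_inner_add_add_self, nE, iEF, nF]; ring
  have hK0 : G + H ≠ 0 := by
    intro h0
    rw [h0, smul_zero] at Eii
    have h1 : A + B = 0 := (smul_eq_zero.1 Eii.symm).resolve_left (by linarith)
    rw [h1, inner_zero_left] at nApB
    linarith
  have hKK : 0 < ⟪G + H, G + H⟫ := real_inner_self_pos.2 hK0
  -- the two relations along `ℓ`: `S • (A + B) = (−R) • K`, `T • (E + F) = R' • K` with `K = G + H`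
  obtain ⟨S, hS⟩ : ∃ s : ℝ, s = ⟪u, u⟫ / 4 := ⟨_, rfl⟩
  obtain ⟨T, hT⟩ : ∃ t : ℝ, t = ⟪v, v⟫ / 4 := ⟨_, rfl⟩
  have hRS : R = 1 - S := by rw [hR, hS]
  have hRT : R' = 1 - T := by rw [hR', hT]
  have hSpos : 0 < S := by rw [hS]; positivity
  have hTpos : 0 < T := by rw [hT]; positivity
  have hS2 : S ≤ 1 / 2 := by linarith
  have hT2 : T ≤ 1 / 2 := by linarith
  have hSAB : S • (A + B) = (-R) • (G + H) := by
    have e1 : S • (A + B) = -((R - 1) • (A + B)) := by rw [hRS]; module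
    rw [e1, ← Eii]; module
  have hTEF : T • (E + F) = R' • (G + H) := by
    have e1 : T • (E + F) = -((R' - 1) • (E + F)) := by rw [hRT]; module
    rw [e1, ← Eii', hCD]; module
  -- ### Part 4: `x` lies on `ℓ`
  have CX1 := circle_of_dist_eq_one hxa hxb
  have CX2 := circle_of_dist_eq_one hxe hxf
  obtain ⟨X1, hX1⟩ : ∃ w : EuclideanSpace ℝ (Fin 3), w = x - a - (1 / 2 : ℝ) • (b - a) := ⟨_, rfl⟩
  obtain ⟨X2, hX2⟩ : ∃ w : EuclideanSpace ℝ (Fin 3), w = x - e - (1 / 2 : ℝ) • (f - e) := ⟨_, rfl⟩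
  rw [← hX1] at CX1
  rw [← hX2] at CX2
  obtain ⟨oX1, nX1⟩ := CX1
  obtain ⟨oX2, nX2⟩ := CX2
  rw [dBA, nBA] at nX1
  rw [dFE, nFE] at nX2
  replace nX1 : ⟪X1, X1⟫ = 3 / 4 := by rw [nX1]; norm_num
  replace nX2 : ⟪X2, X2⟫ = 3 / 4 := by rw [nX2]; norm_num
  rw [dBA] at oX1
  rw [dFE] at oX2
  have oX1v : ⟪X1, v⟫ = 0 := by
    have q := congrArg (fun z => ⟪X1, z⟫) Ei
    simp only [real_inner_smul_right] at q
    rw [oX1, mul_zero, ← hvHG] at q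
    exact (mul_eq_zero.1 q).resolve_left (by linarith)
  have oX2u : ⟪X2, u⟫ = 0 := by
    have q := congrArg (fun z => ⟪X2, z⟫) Ei'
    simp only [real_inner_smul_right] at q
    rw [oX2, mul_zero, ← huDC] at q
    exact (mul_eq_zero.1 q).resolve_left (by linarith)
  have oABv : ⟪A + B, v⟫ = 0 := by
    have q := congrArg (fun z => ⟪z, v⟫) hSAB
    simp only [real_inner_smul_left] at q
    rw [oKv, mul_zero] at q
    exact (mul_eq_zero.1 q).resolve_left hSpos.ne'
  have oEFu : ⟪E + F, u⟫ = 0 := by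
    have q := congrArg (fun z => ⟪z, u⟫) hTEF
    simp only [real_inner_smul_left] at q
    rw [oKu, mul_zero] at q
    exact (mul_eq_zero.1 q).resolve_left hTpos.ne'
  obtain ⟨W, hW⟩ : ∃ w : EuclideanSpace ℝ (Fin 3), w = x - c - (1 / 2 : ℝ) • u := ⟨_, rfl⟩
  have hW1 : W = X1 + (1 / 2 : ℝ) • (A + B) := by rw [hW, hX1, hA, hB]; module
  have hW2 : W = X2 + (1 / 2 : ℝ) • (E + F) + (1 / 2 : ℝ) • (G + H) := by
    rw [hW, hX2, hE, hF, hG, hH, hu, hv]; module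
  have oWv : ⟪W, v⟫ = 0 := by
    rw [hW1, inner_add_left, real_inner_smul_left, oX1v, oABv]; ring
  have oWu : ⟪W, u⟫ = 0 := by
    rw [hW2, inner_add_left, inner_add_left, real_inner_smul_left, real_inner_smul_left, oX2u, oEFu, oKu]; ring
  -- three vectors `v, K, W ⊥ u` are dependent; `v ⊥ K`, `v ⊥ W`, `K ≠ 0` ⇒ `W = l • K`
  obtain ⟨α, β, γ, hne, hrel⟩ := exists_rel_of_orthogonal hu0 ovu oKu oWu
  have h1 := inner_rel_eq_zero (v := v) hrel
  rw [oKv, oWv, mul_zero, mul_zero, add_zero, add_zero] at h1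
  have hα : α = 0 := (mul_eq_zero.1 h1).resolve_right hvv.ne'
  rw [hα, zero_smul, zero_add] at hrel
  have hγ : γ ≠ 0 := by
    intro h0
    rw [h0, zero_smul, add_zero, smul_eq_zero] at hrel
    rcases hne with h2 | h2 | h2
    · exact h2 hα
    · exact (hrel.resolve_left h2 |> hK0)
    · exact h2 h0
  obtain ⟨l, hl⟩ : ∃ l : ℝ, l = -β / γ := ⟨_, rfl⟩
  have hWK : W = l • (G + H) := by
    have e1 : W = γ⁻¹ • (γ • W) := by rw [smul_smul, inv_mul_cancel₀ hγ, one_smul]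
    have e2 : γ • W = -(β • (G + H)) := eq_neg_of_add_eq_zero_right hrel
    rw [e1, e2, hl]; module
  -- ### Part 5: the endgame on both sides of `ℓ`
  obtain ⟨κ, hκ⟩ : ∃ k : ℝ, k = ⟪G + H, G + H⟫ := ⟨_, rfl⟩
  rw [← hκ] at hKK
  -- side `ab`: `l ≤ 0`
  have hSX1 : S • X1 = (S * l + R / 2) • (G + H) := by
    have e1 : S • X1 = S • W - (1 / 2 : ℝ) • (S • (A + B)) := by rw [hW1]; module
    rw [e1, hWK, hSAB]; module
  have E1 : S * (S * (3 / 4)) = (S * l + R / 2) * ((S * l + R / 2) * κ) := by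
    have q := congrArg (fun z => ⟪z, z⟫) hSX1
    simp only [real_inner_smul_left, real_inner_smul_right] at q
    rw [nX1, ← hκ] at q
    exact q
  have E3 : S * (S * (4 * R - 1)) = R * (R * κ) := by
    have q := congrArg (fun z => ⟪z, z⟫) hSAB
    simp only [real_inner_smul_left, real_inner_smul_right] at q
    rw [nApB, ← hκ] at q
    linarith [q]
  have E2 : 1 ≤ l * (l * κ) + S := by
    have e1 : x - c = W + (1 / 2 : ℝ) • u := by rw [hW]; module
    have q : ⟪x - c, x - c⟫ = dist x c ^ 2 := inner_self_eq_of_dist rfl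
    rw [e1, real_inner_add_add_self, real_inner_smul_right, real_inner_smul_left, real_inner_smul_right, oWu,
      hWK, real_inner_smul_left, real_inner_smul_right, ← hκ] at q
    have q2 : (1 : ℝ) ≤ dist x c ^ 2 :=
      calc (1 : ℝ) = 1 * 1 := by ring
        _ ≤ dist x c * dist x c := mul_le_mul sxc sxc zero_le_one (zero_le_one.trans sxc)
        _ = dist x c ^ 2 := by ring
    rw [hS]
    linarith only [q, q2]
  have hl0 : l ≤ 0 := line_param_nonpos hSpos (by linarith only [hRhalf]) hKK hRS hS2 E1 E3 E2
  -- side `ef`: `1/2 − l ≤ 0`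
  have hTX2 : T • X2 = (-(T * (1 / 2 - l) + R' / 2)) • (G + H) := by
    have e1 : T • X2 = T • W - (T / 2) • (G + H) - (1 / 2 : ℝ) • (T • (E + F)) := by rw [hW2]; module
    rw [e1, hWK, hTEF]; module
  have E1' : T * (T * (3 / 4)) = (T * (1 / 2 - l) + R' / 2) * ((T * (1 / 2 - l) + R' / 2) * κ) := by
    have q := congrArg (fun z => ⟪z, z⟫) hTX2
    simp only [real_inner_smul_left, real_inner_smul_right] at q
    rw [nX2, ← hκ] at q
    linarith [q]
  have E3' : T * (T * (4 * R' - 1)) = R' * (R' * κ) := by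
    have q := congrArg (fun z => ⟪z, z⟫) hTEF
    simp only [real_inner_smul_left, real_inner_smul_right] at q
    rw [nEpF, ← hκ] at q
    exact q
  have E2' : 1 ≤ (1 / 2 - l) * ((1 / 2 - l) * κ) + T := by
    have e1 : x - g = W - (1 / 2 : ℝ) • (G + H) + (1 / 2 : ℝ) • v := by rw [hW, hG, hH, hu, hv]; module
    have q : ⟪x - g, x - g⟫ = dist x g ^ 2 := inner_self_eq_of_dist rfl
    have e2 : W - (1 / 2 : ℝ) • (G + H) = (l - 1 / 2) • (G + H) := by rw [hWK]; module
    rw [e1, e2, real_inner_add_add_self, real_inner_smul_left, real_inner_smul_right, real_inner_smul_left,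
      real_inner_smul_right, real_inner_smul_left, real_inner_smul_right, oKv, ← hκ] at q
    have q2 : (1 : ℝ) ≤ dist x g ^ 2 :=
      calc (1 : ℝ) = 1 * 1 := by ring
        _ ≤ dist x g * dist x g := mul_le_mul sxg sxg zero_le_one (zero_le_one.trans sxg)
        _ = dist x g ^ 2 := by ring
    rw [hT]
    linarith only [q, q2]
  have hl1 : 1 / 2 - l ≤ 0 := line_param_nonpos hTpos (by linarith only [hR'half]) hKK hRT hT2 E1' E3' E2'
  linarith only [hl0, hl1]

/-! ### 3. The pattern `Nine22B` -/

/-- **`Nine22B` is not realisable** (graph6 `HQyvex{`; labels of `ObstructionPatterns.Nine22BEdges`: snub disphenoid on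
`0,1,2,3,4,5,7,8` with degree-4 vertices `0,1,4,5`, cone vertex `6`). This is the hypothesis `hN` of
`ContactNine.maxContacts_three_nine_of_no_Nine22B`. [folklore] -/
theorem no_Nine22B (p : Fin 9 → EuclideanSpace ℝ (Fin 3))
    (hE : ∀ e ∈ Nine22BEdges, dist (p e.1) (p e.2) = 1) (hN : ∀ i j : Fin 9, i ≠ j → 1 ≤ dist (p i) (p j)) :
    False := by
  have c : ∀ i j : Fin 9, (i, j) ∈ Nine22BEdges → dist (p j) (p i) = 1 := fun i j h => by
    rw [dist_comm]; exact hE (i, j) h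
  have c' : ∀ i j : Fin 9, (i, j) ∈ Nine22BEdges → dist (p i) (p j) = 1 := fun i j h => hE (i, j) h
  have ne : ∀ i j : Fin 9, i ≠ j → p i ≠ p j := fun i j h hp => by
    have := hN i j h; rw [hp, dist_self] at this; linarith
  exact no_snub_disphenoid_cone (a := p 0) (b := p 1) (c := p 2) (d := p 3) (e := p 4) (f := p 5) (g := p 7)
    (h := p 8) (x := p 6)
    (c' 0 2 (by decide)) (c' 0 3 (by decide)) (c' 1 2 (by decide)) (c' 1 3 (by decide))
    (c 2 7 (by decide)) (c 3 7 (by decide)) (c 2 8 (by decide)) (c 3 8 (by decide))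
    (c' 4 7 (by decide)) (c' 4 8 (by decide)) (c' 5 7 (by decide)) (c' 5 8 (by decide))
    (c' 0 1 (by decide)) (c 0 7 (by decide)) (c 1 8 (by decide))
    (c' 4 5 (by decide)) (c' 2 4 (by decide)) (c' 3 5 (by decide))
    (c 0 6 (by decide)) (c 1 6 (by decide)) (c 4 6 (by decide)) (c 5 6 (by decide))
    (hN 2 3 (by decide)) (hN 7 8 (by decide)) (ne 7 1 (by decide)) (ne 0 8 (by decide)) (ne 2 5 (by decide))
    (ne 4 3 (by decide)) (hN 6 2 (by decide)) (hN 6 7 (by decide))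

end Summit.Ventures.Crystal3D

end
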